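import Summits.Schanuel.Schanuel.Theorems.SoloInformedPointwiseTransfer
import Summits.Schanuel.Schanuel.Theorems.SoloInformedGenericStructuredRoots
import Summits.Schanuel.Schanuel.Theorems.SoloInformedGenericGelfondInput
import Summits.Schanuel.Schanuel.Theorems.SoloInformedDerivativeGcdRadical

/-!
# Theorem AE-1τ, middle: Roy's additive data WITH derivatives → a Gel'fond input

Soloist file (informed mode, seat `solo-Schanuel-informed`, s180).  The per-`n` step of the
seat's THEOREM AE-1τ (`paper/AE-note.md` §9, `η = 0` form) on the node
`RoyAdditiveDirichletExponent` ([cite: Roy2010, Thm 1.1]), CONDITIONAL on D. Roy's pointwise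
transfer estimate [cite: Roy2010, Cor 3.2] carried as the displayed hypothesis `(hR1 : cor_3_2)`.

`soloAT_gelfond_input`: let `P ∈ RoyAdditiveSmall ξ β σ τ ν n` (so `|P^{[j]}(cξ)| ≤ exp(-n^ν)`
for `c ≤ n^σ`, `j ≤ n^τ`), `K ≤ n^σ`, `K ≥ 1000`, `2 ≤ t`, `2(t - 1) ≤ n^τ`, `K t ≤ n`.  The
family `P^{[a]}`, `a < t`, consists of non-zero polynomials (the leading-coefficient remark
`soloAT_rpow_lt_natDegree`: `deg P > n^τ`) of degree `≤ n`, sup-norm `≤ 2^n exp(n^β)`, whose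
divided derivatives of order `< t` are `≤ exp(-(n^ν - n^τ))` at the `cξ`, `1 ≤ c ≤ K`.  By
`soloPT_few_bad_points_card` the primitive gcd `Q` satisfies `|Q(cξ)| ≤ exp(-n^ν/2)` off a set
`E` with `200·#E ≤ K`; its radical `R` vanishes at the roots of `Q`, has `t · deg R ≤ n` and
`t · log M(R) ≤ log M(P) ≤ 2 n^β` (`soloDG_*`, [cite: Roy2010, §1 p. 4, step (3)]); then
`soloGS_structured_roots` and `soloGG_gelfond_input` (with `D₀ = n/t`, `L₀ = 2n^β/t`,
`V = n^ν/2`, `W = V K / (400 n)`) give a non-zero `Q' ∈ ℤ[X]` with `deg Q' ≤ 20 (n/t) / K`,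
type `≤ (20 (n/t)/K)(2 + log K) + 20 (2n^β/t)/K` and `|Q'(ξ)| ≤ exp(-W/2)` — given the seven
explicit inequalities `hA, hbud, h₁, …, h₆` (all eventually true when `ν > β + 4(1 - σ - τ)`;
the asymptotic bookkeeping and Gel'fond's criterion are the next file).

What this is NOT.  Conditional on [cite: Roy2010, Cor 3.2] as displayed; not yet THEOREM
AE-1τ, and nothing here bears on `Literature.Periods.SchanuelConjecture` (the seat's verdict,
no path, is unchanged); the node [cite: Roy2010, Thm 1.1] is not claimed.  Tree files and
Mathlib only; no definitions; axioms the standard three.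
-/

namespace Summit.Schanuel.Schanuel.Theorems

open Polynomial Finset UniqueFactorizationMonoid
open Literature.NumberTheory.Transcendental.Roy2010 (cor_3_2)

/-- The leading-coefficient remark: a polynomial of `RoyAdditiveSmall ξ β σ τ ν n` (`n ≥ 1`)
has degree `> n^τ` (else `P^{[deg P]} = lc(P)`, an integer `≥ 1` in absolute value, would be
`≤ exp(-n^ν) < 1` at the point `0·ξ`). -/
theorem soloAT_rpow_lt_natDegree {ξ : ℂ} {β σ τ ν : ℝ} {n : ℕ} (hn : 1 ≤ n) {P : ℤ[X]}
    (hP : P ∈ RoyAdditiveSmall ξ β σ τ ν n) : (n : ℝ) ^ τ < P.natDegree := by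
  obtain ⟨hP0, -, -, hsmall⟩ := hP
  have hn0 : (0 : ℝ) < n := by exact_mod_cast hn
  by_contra h
  rw [not_lt] at h
  have hv := hsmall 0 P.natDegree (by rw [Nat.cast_zero]; positivity) h
  have hD : (hasseDeriv P.natDegree P).natDegree = 0 := by
    have := natDegree_hasseDeriv_le P P.natDegree
    rw [Nat.sub_self, Nat.le_zero] at this
    exact this
  have hc : (hasseDeriv P.natDegree P).coeff 0 = P.leadingCoeff := by
    rw [hasseDeriv_coeff, zero_add, Nat.choose_self, Nat.cast_one, one_mul, coeff_natDegree]
  rw [eq_C_of_natDegree_eq_zero hD, hc, aeval_C, algebraMap_int_eq, eq_intCast,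
    Complex.norm_intCast] at hv
  have h1 : (1 : ℝ) ≤ |((P.leadingCoeff : ℤ) : ℝ)| := by
    exact_mod_cast Int.one_le_abs (leadingCoeff_ne_zero.mpr hP0)
  have h2 : Real.exp (-(n : ℝ) ^ ν) < 1 := Real.exp_lt_one_iff.mpr (by
    have : 0 < (n : ℝ) ^ ν := by positivity
    linarith)
  linarith

/-- **AE-1τ per `n` (conditional on [Roy2010, Cor 3.2]).**  See the module docstring. -/
theorem soloAT_gelfond_input (hR1 : cor_3_2) {ξ : ℂ} (hξ : Transcendental ℚ ξ)
    {β σ τ ν : ℝ} (hβ : 1 ≤ β) {n K t : ℕ} (hn : 1 ≤ n) (hK : 1000 ≤ K)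
    (hKσ : (K : ℝ) ≤ (n : ℝ) ^ σ) (ht2 : 2 ≤ t) (htτ : 2 * ((t : ℝ) - 1) ≤ (n : ℝ) ^ τ)
    (hKt : K * t ≤ n) {c₁ : ℝ} (hc : Real.exp (-c₁) ≤ min 1 (‖ξ‖ / 2))
    (hA : (n : ℝ) ^ ν / 8 ≤ ((n : ℝ) ^ ν - (n : ℝ) ^ τ) - (n : ℝ) ^ ν / 2 -
      4 * n * Real.log (2 + K * ‖ξ‖) + n * Real.log (min 1 ‖ξ‖))
    (hbud : 200 * (10 * (n : ℝ) ^ 2 + 2 * n * (n + (n : ℝ) ^ β)) ≤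
      K * (t * ((n : ℝ) ^ ν / 8)))
    (h₁ : 2 * c₁ * n ≤ (n : ℝ) ^ ν / 2)
    (h₂ : Real.exp (-((n : ℝ) ^ ν / 2 * K / (400 * n))) ≤ 1 / 2)
    (h₃ : 4 * Real.exp (-((n : ℝ) ^ ν / 2 * K / (400 * n))) ≤ ‖ξ‖)
    (h₄ : Real.log (8 * (K * ‖ξ‖ + 1)) ≤ (n : ℝ) ^ ν / 2 * K / (800 * n))
    (h₅ : 11000 * (2 * ((n : ℝ) / t) ^ 3 * (2 * (n : ℝ) ^ β / t) + 2 * ((n : ℝ) / t) ^ 4) ≤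
      (K : ℝ) ^ 3 * ((n : ℝ) ^ ν / 2 * K / (800 * n)))
    (h₆ : 20 * ((n : ℝ) / t) / K * Real.log (K * ‖ξ‖ + 1) + 20 * (2 * (n : ℝ) ^ β / t) / K ≤
      (n : ℝ) ^ ν / 2 * K / (400 * n) / 2)
    {P : ℤ[X]} (hP : P ∈ RoyAdditiveSmall ξ β σ τ ν n) :
    ∃ Q : ℤ[X], Q ≠ 0 ∧ (Q.natDegree : ℝ) ≤ 20 * ((n : ℝ) / t) / K ∧
      Q.gelfondType ≤ 20 * ((n : ℝ) / t) / K * (2 + Real.log K) +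
        20 * (2 * (n : ℝ) ^ β / t) / K ∧
      ‖aeval ξ Q‖ ≤ Real.exp (-((n : ℝ) ^ ν / 2 * K / (400 * n) / 2)) := by
  classical
  have hdegτ := soloAT_rpow_lt_natDegree hn hP
  obtain ⟨hP0, hdeg, hht, hsmall⟩ := hP
  have hn0 : (0 : ℝ) < n := by exact_mod_cast hn
  have ht0 : 0 < t := by omega
  have ht0' : (0 : ℝ) < t := by exact_mod_cast ht0
  have hξ0 : ξ ≠ 0 := by
    intro h
    apply hξ
    rw [h]
    exact isAlgebraic_zero
  -- the family of divided derivatives `P^{[a]}`, `a < t`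
  set Pf : Fin t → ℤ[X] := fun i => hasseDeriv (i : ℕ) P with hPf
  have hat : ∀ a j : ℕ, a < t → j < t → ((j + a : ℕ) : ℝ) ≤ (n : ℝ) ^ τ := by
    intro a j ha hj
    have h : j + a ≤ 2 * (t - 1) := by omega
    have h' : ((j + a : ℕ) : ℝ) ≤ ((2 * (t - 1) : ℕ) : ℝ) := by exact_mod_cast h
    have h'' : ((2 * (t - 1) : ℕ) : ℝ) = 2 * ((t : ℝ) - 1) := by
      rw [Nat.cast_mul, Nat.cast_sub (by omega)]
      push_cast
      ring
    linarith
  have haP : ∀ a : ℕ, a < t → a ≤ P.natDegree := by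
    intro a ha
    have h1 := hat a 0 ha ht0
    rw [zero_add] at h1
    have h2 : (a : ℝ) < P.natDegree := lt_of_le_of_lt h1 hdegτ
    exact_mod_cast h2.le
  have hPf0 : ∀ i, Pf i ≠ 0 := fun i => soloDG_hasseDeriv_ne_zero hP0 (haP i i.2)
  have hPfdeg : ∀ i, (Pf i).natDegree ≤ n := fun i =>
    ((natDegree_hasseDeriv_le P i).trans (Nat.sub_le _ _)).trans hdeg
  set H : ℝ := 2 ^ n * Real.exp ((n : ℝ) ^ β) with hH
  have hH1 : 1 ≤ H := by
    have h1 : (1 : ℝ) ≤ 2 ^ n := one_le_pow₀ (by norm_num)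
    have h2 : (1 : ℝ) ≤ Real.exp ((n : ℝ) ^ β) := Real.one_le_exp (by positivity)
    nlinarith
  have hlogH : Real.log H ≤ n + (n : ℝ) ^ β := by
    rw [hH, Real.log_mul (by positivity) (Real.exp_pos _).ne', Real.log_exp, Real.log_pow]
    have : (n : ℝ) * Real.log 2 ≤ n := by
      have h := Real.log_two_lt_d9
      nlinarith
    linarith
  have hPfH : ∀ i, (Pf i).supNorm ≤ H := by
    intro i
    calc (Pf i).supNorm ≤ 2 ^ P.natDegree * P.supNorm := soloDG_supNorm_hasseDeriv_le P i
      _ ≤ 2 ^ n * Real.exp ((n : ℝ) ^ β) :=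
          mul_le_mul (pow_le_pow_right₀ (by norm_num) hdeg)
            ((supNorm_le_polyHeight P).trans hht) P.supNorm_nonneg (by positivity)
  have hval : ∀ c ∈ Icc 1 K, ∀ i : Fin t, ∀ j : ℕ, j < t →
      ‖aeval ((c : ℂ) * ξ) (hasseDeriv j (Pf i))‖ ≤
        Real.exp (-((n : ℝ) ^ ν - (n : ℝ) ^ τ)) := by
    intro c hc i j hj
    have h2e : (2 : ℝ) ^ (j + i) ≤ Real.exp ((j + i : ℕ) : ℝ) := by
      rw [← mul_one ((j + i : ℕ) : ℝ), Real.exp_nat_mul]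
      exact pow_le_pow_left₀ (by norm_num) (by linarith [Real.add_one_le_exp (1 : ℝ)]) _
    have hcσ : (c : ℝ) ≤ (n : ℝ) ^ σ := by
      have : (c : ℝ) ≤ K := by exact_mod_cast (Finset.mem_Icc.mp hc).2
      exact this.trans hKσ
    have hs := hsmall c (j + i) hcσ (hat i j i.2 hj)
    calc ‖aeval ((c : ℂ) * ξ) (hasseDeriv j (Pf i))‖
        ≤ 2 ^ (j + i) * ‖aeval ((c : ℂ) * ξ) (hasseDeriv (j + i) P)‖ :=
          soloDG_norm_aeval_hasseDeriv_hasseDeriv_le P _ j i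
      _ ≤ Real.exp ((j + i : ℕ) : ℝ) * Real.exp (-(n : ℝ) ^ ν) :=
          mul_le_mul h2e hs (norm_nonneg _) (Real.exp_pos _).le
      _ ≤ Real.exp ((n : ℝ) ^ τ) * Real.exp (-(n : ℝ) ^ ν) :=
          mul_le_mul_of_nonneg_right (Real.exp_le_exp.mpr (hat i j i.2 hj))
            (Real.exp_pos _).le
      _ = Real.exp (-((n : ℝ) ^ ν - (n : ℝ) ^ τ)) := by rw [← Real.exp_add]; ring_nf
  -- Step T′: few bad points for the primitive gcd `Q`
  have hA0 : 0 < (n : ℝ) ^ ν / 8 := by positivity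
  have hbud' : 200 * (10 * (n : ℝ) ^ 2 + 2 * n * Real.log H) ≤ K * (t * ((n : ℝ) ^ ν / 8)) := by
    have : 2 * (n : ℝ) * Real.log H ≤ 2 * n * (n + (n : ℝ) ^ β) :=
      mul_le_mul_of_nonneg_left hlogH (by positivity)
    linarith
  have hE := soloPT_few_bad_points_card hR1 hξ0 (by omega) ht0 hKt ht2 hPf0 hPfdeg hH1 hPfH
    hval hA0 hA hbud'
  have hoff := soloPT_small_off_bad ξ K Pf ((n : ℝ) ^ ν / 2)
  set Q := ((univ : Finset (Fin t)).gcd Pf).primPart with hQ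
  set E := (Icc 1 K).filter fun c : ℕ => Real.exp (-((n : ℝ) ^ ν / 2)) <
    ‖aeval ((c : ℂ) * ξ) Q‖ with hEdef
  have hQ0 : Q ≠ 0 := primPart_ne_zero _
  have hQprim : Q.IsPrimitive := isPrimitive_primPart _
  have hdvd : ∀ j < t, Q ∣ hasseDeriv j P := fun j hj =>
    soloDG_primPart_gcd_hasseDeriv_dvd P t hj
  have hQP : Q ∣ P := by
    have h := hdvd 0 ht0
    rwa [hasseDeriv_zero'] at h
  have hQdeg : Q.natDegree ≤ n := (natDegree_le_of_dvd hQP hP0).trans hdeg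
  -- the radical `R` of `Q`
  set R := radical Q with hR
  have hR0 : R ≠ 0 := radical_ne_zero
  have hQR : ∀ z : ℂ, aeval z Q = 0 → aeval z R = 0 := fun z hz =>
    soloDG_aeval_radical_eq_zero hQ0 hz
  have hD : (R.natDegree : ℝ) ≤ (n : ℝ) / t := by
    rw [le_div_iff₀ ht0']
    have h := (soloDG_mul_natDegree_radical_le hQprim hdvd hP0).trans hdeg
    have h' : ((t * (radical Q).natDegree : ℕ) : ℝ) ≤ n := by exact_mod_cast h
    push_cast at h'
    linarith
  obtain ⟨hlogM0, hlogM⟩ := soloSR_log_mahlerMeasure_le hP0 hn hdeg hβ hht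
  have hMR1 : 1 ≤ (R.map (Int.castRingHom ℂ)).mahlerMeasure :=
    Polynomial.one_le_mahlerMeasure_of_ne_zero hR0
  have hL : Real.log (R.map (Int.castRingHom ℂ)).mahlerMeasure ≤ 2 * (n : ℝ) ^ β / t := by
    rw [le_div_iff₀ ht0']
    have h := soloDG_mahlerMeasure_radical_pow_le hQprim hdvd hP0
    have h' := Real.log_le_log (pow_pos (by linarith) t) h
    rw [Real.log_pow] at h'
    linarith
  have hD₀ : (0 : ℝ) < (n : ℝ) / t := by positivity
  have hL₀ : (0 : ℝ) < 2 * (n : ℝ) ^ β / t := by positivity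
  -- Steps 1–3: structured roots of `R`
  obtain ⟨S', hS'sub, hS'card, γ, μ, hμ, hroots⟩ :=
    soloGS_structured_roots hn hK hQ0 hQdeg hR0 hQR hD hL E hE hc h₁ hoff h₂ h₃ h₄ h₅
  -- Steps 4–5: the Gel'fond input
  exact soloGG_gelfond_input hξ hK hR0 hD₀ hL₀ hD hL hS'sub hS'card hμ hroots h₆

end Summit.Schanuel.Schanuel.Theorems
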